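import Summits.RiemannHypothesis.RiemannHypothesis.Theorems.TiltedLandingLaw421R3PairCount
import Summits.RiemannHypothesis.RiemannHypothesis.Theorems.TiltedLandingLaw421R3TouchedDissipation
import Summits.RiemannHypothesis.RiemannHypothesis.Theorems.TiltedLandingLaw421R3ColumnImmunity2

/-! # TiltedLandingLaw421R3PairWindow — K-1′: the PAIR WINDOW and `childEnergy(Ū) ≤ Im u₁² + Im u₂²` (lens-2's `ChildEnergyTwoLeQ`, unfolded) — W-08 C1 (rh-idea-5 g35), file 2 of 2

SUPPORT module for crux `TiltedLandingLaw421R` ⟨stmt-RiemannHypothesis-33346⟩, route EarlyAppointments (`--supports … --as helper` only; no stub, no crux,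
no placeholder).  It proves, over the TREE names of #1178 `…R3TouchedDissipation` (`Touches`, `AtomicPair`, `pairUnion`, `childEnergy`,
`stateKappa`) and of the RATE files (`newtonK`, `StTrkDQ`, `EngineHyps5 2`), the statement of lens-2's RUNG-P door `RhW08.PerturbativeRung.ChildEnergyTwoLeQ`
(RungP-v4/v5 block, token-identical; HELD until GO-33-28 lands) with `BetaLevel` replaced by the ONE conjunct it uses (`StTrkDQ … j v` of `IsLowest`):
★★★ `childEnergy_two_le` — legal frame, band state `v` of level `j` touched by a strictly taller zero `z` of `f⁽ʲ⁾` (`Touches`), the pair atomic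
(`AtomicPair`), the state floor `30 ≤ Im v·κ_v` and the toucher-side field floor `3/2 < Im z·‖newtonK f j z‖`; two DISTINCT zeros `u₁ ≠ u₂` of
`f⁽ʲ⁺¹⁾` off `Z(f⁽ʲ⁾)` in the half-Newton discs of `v` and of `z` ⇒ `childEnergy f j (pairUnion v z) ≤ Im u₁² + Im u₂²`.
After GO-33-28, `ChildEnergyTwoLeQ` by name is `intro …; obtain ⟨-, -, hlow, ht, ha⟩ := hβ; exact childEnergy_two_le hE hlow.1 ht ha …` (3 lines;
`Charged`, `ApproachLevelQ` and lowest-ness are NOT used).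
THE ROUTE, and the one deviation from the docstring of `ChildEnergyTwoLeQ` («corollary of #1174 `clusterCount_of_charged`»): `clusterCount_of_charged`
needs the window base inside the LAW's range `|c − x₀| < (j+3)R/2` (local B from `Charged`); the pair window must contain BOTH closed shadows
`[Re v − Im v, Re v + Im v] ∪ [Re z − Im z, Re z + Im z]`, and no binder confines the toucher's shadow to that range when `j ∈ {0, 1}` (band budget
`ρ + Im v ≤ √(j+1)·Hs` and `Im z ≤ Hs ≤ R/2` give `Re z + Im z − x₀ ≤ (√(j+1) + 3)·R/2`, `< (j+3)R/2` only for `j ≥ 2`).  So the count used is the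
INEQUALITY W1≤ of file 1 (`RhW08.PairCount.clusterCount_le`, Kim's `J′ ≤ J`): NO local B, NO range, NO `Charged`; `≤ 2` suffices because the two located
children are distinct members of weight `≥ 1`, so the count IS `2` and they exhaust the window.
§1 ★★ `pairWindow` (frame STEP 0 + STEP 1 = C1 g34's `stub_pairWindow` WITHOUT its range clause and without `Charged`): admissible CLEAN endpoints
exist — near others: finitely many zeros of `f⁽ʲ⁾ ≢ 0` in a box (`RhW08.SuccB.finite_zeros_box`); far others: strip heredity `|Im u| ≤ Hs`
(`RhW08.Column.abs_im_le_of_level`); clean feet off the discrete real zero sets (`RhW08.Column.exists_real_ne_zero_ne_zero`, `…R3ColumnImmunity2`);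
clearance and the window identity `{upper zeros with abscissa in (α, β)} = {v, z}` from file 1 §3.  §2 half-Newton-disc geometry (`‖u − (w − K⁻¹)‖ ≤ 1/(2‖K‖)`,
`3/2 < Im w·‖K‖` ⇒ `Re u ∈ (Re w − Im w, Re w + Im w)`, `0 < Im u`; the floor `30 ≤ Im v·‖K + i/(2 Im v)‖` gives `59/2 ≤ Im v·‖K‖`; the upper part of `Ū` has
abscissae in `(α, β)`) — C1 g34's `PairWindowGeometry-v2` b564f84c re-homed, bodies verbatim; `exists_strict_bound` from `PairEndpoints` ace4b80e.  §3 the theorem.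
NOT CLAIMED: anything about `PerturbativeDropLightQ` / `NearMassMonotoneQ` / RUNG-P / C′ / ★A; no equality `childEnergy = Im u₁² + Im u₂²` is exported.
Nothing here bears on the truth of RH; RH is NOT proved; RUNG-P a candidate; ★A / 33346 / 33347 OPEN; checked ≠ landed ≠ proved. -/

namespace RhW08.PairWindow

open Complex ComplexConjugate Set Metric
open Literature.Analysis.Complex
open Summit.RiemannHypothesis.RiemannHypothesis.Theorems.Splittings.JensenWindow
open RhW08.PairCount
open RhIdea6.G17.W07C7 RhIdea6.G17.W07C7.Rev6 RhW08.QuadW RhW08.AntiEscapeSplit7 RhW08.BurgersRate RhW08.TouchedDissipation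

/-! ## §1 ADMISSIBLE CLEAN ENDPOINTS and the PAIR WINDOW (frame STEP 0 + STEP 1; C1 g34's `stub_pairWindow` WITHOUT its range clause) -/

/-- a finite set of reals all `< m` is bounded by some `M < m` with `m − 1 ≤ M`. -/
theorem exists_strict_bound (L : Finset ℂ) {m : ℝ} (hlt : ∀ u ∈ L, u.re + u.im < m) :
    ∃ M : ℝ, m - 1 ≤ M ∧ M < m ∧ ∀ u ∈ L, u.re + u.im ≤ M := by
  rcases L.eq_empty_or_nonempty with hL | hL
  · exact ⟨m - 1, le_rfl, by linarith, by simp [hL]⟩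
  · obtain ⟨u₀, hu₀, hmax⟩ := L.exists_max_image (fun u => u.re + u.im) hL
    refine ⟨max (u₀.re + u₀.im) (m - 1), le_max_right _ _, max_lt (hlt u₀ hu₀) (by linarith), ?_⟩
    intro u hu
    exact (hmax u hu).trans (le_max_left _ _)

/-- (K) §1 mirror of `exists_strict_bound`: a finite set of reals all `> m'` is bounded below by some `M' > m'` with `M' ≤ m' + 1`. -/
theorem exists_strict_lower_bound (Rs : Finset ℂ) {m' : ℝ} (hgt : ∀ u ∈ Rs, m' < u.re - u.im) :
    ∃ M' : ℝ, m' < M' ∧ M' ≤ m' + 1 ∧ ∀ u ∈ Rs, M' ≤ u.re - u.im := by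
  rcases Rs.eq_empty_or_nonempty with hR | hR
  · exact ⟨m' + 1, by linarith, le_rfl, by simp [hR]⟩
  · obtain ⟨u₀, hu₀, hmin⟩ := Rs.exists_min_image (fun u => u.re - u.im) hR
    refine ⟨min (u₀.re - u₀.im) (m' + 1), lt_min (hgt u₀ hu₀) (by linarith), min_le_right _ _, ?_⟩
    intro u hu
    exact (min_le_left _ _).trans (hmin u hu)

/-- ★★ (K) §1 **THE PAIR WINDOW** (frame STEP 0 + STEP 1).  Legal frame, band state `v` of level `j`, a zero `z` of `f⁽ʲ⁾` strictly taller than `v`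
whose closed Jensen shadow meets `v`'s (`Touches` unfolded), the pair atomic (`AtomicPair` unfolded).  THEN there are abscissae `α < Re v < β` with
`α ≤ min(Re v − Im v, Re z − Im z)`, `max(Re v + Im v, Re z + Im z) ≤ β`, each crossed by no open Jensen shadow of `f⁽ʲ⁾`, clean feet
(`f⁽ʲ⁾ f⁽ʲ⁺¹⁾ ≠ 0` at `α, β`), and the upper zeros of `f⁽ʲ⁾` with abscissa in `(α, β)` are EXACTLY `{v, z}`.
Choice: `α ∈ (M, m)` with `m − 1 ≤ M` above `Re u + Im u` of the finitely many other upper zeros in the box `(m − Hs − 2, Re v + 1) × (−Hs−1, Hs+1)`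
(`RhW08.SuccB.finite_zeros_box`); the other upper zeros further left clear `α` by strip heredity `Im u ≤ Hs`; clean by `exists_real_ne_zero_ne_zero`.
No clause places `(α, β)` in the LAW's range — none is needed downstream (§2). -/
theorem pairWindow {η : ℝ} {f : ℂ → ℂ} {x₀ s hmax R Hs : ℝ} {B j : ℕ} {v z : ℂ}
    (hE : EngineHyps5 2 η f x₀ s hmax R Hs B) (hv : StTrkDQ η f x₀ s hmax R Hs B j v)
    (hz0 : iteratedDeriv j f z = 0) (hvz : v.im < z.im) (htouch : |v.re - z.re| ≤ v.im + z.im)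
    (hat : ∀ u : ℂ, iteratedDeriv j f u = 0 → 0 < u.im → u ≠ v → u ≠ z → v.im + u.im < |v.re - u.re| ∧ z.im + u.im < |z.re - u.re|) :
    ∃ α β : ℝ, α < v.re ∧ v.re < β ∧ α ≤ v.re - v.im ∧ α ≤ z.re - z.im ∧ v.re + v.im ≤ β ∧ z.re + z.im ≤ β ∧
      (∀ a : ℂ, iteratedDeriv j f a = 0 → a.im ≠ 0 → |a.im| ≤ |α - a.re|) ∧
      (∀ a : ℂ, iteratedDeriv j f a = 0 → a.im ≠ 0 → |a.im| ≤ |β - a.re|) ∧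
      iteratedDeriv j f α ≠ 0 ∧ iteratedDeriv j f β ≠ 0 ∧ iteratedDeriv (j + 1) f α ≠ 0 ∧ iteratedDeriv (j + 1) f β ≠ 0 ∧
      {a : ℂ | (iteratedDeriv j f a = 0 ∧ a.re ∈ Ioo α β) ∧ 0 < a.im} = {v, z} := by
  classical
  have hHs : 0 ≤ Hs := hE.2.2.2.2.2.2.2.1
  have hGd : Differentiable ℂ (iteratedDeriv j f) := differentiable_iteratedDeriv_of_entire hE.1 j
  have hHd : Differentiable ℂ (iteratedDeriv (j + 1) f) := differentiable_iteratedDeriv_of_entire hE.1 (j + 1)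
  have hGne : iteratedDeriv j f ≠ 0 := hv.1
  have hv0 : iteratedDeriv j f v = 0 := hv.2.1
  have hvim : 0 < v.im := hv.2.2.1
  have hvHs : v.im ≤ Hs := hv.2.2.2.2
  have hHne : iteratedDeriv (j + 1) f ≠ 0 := iteratedDeriv_succ_ne_zero_of_zero hE.1 j hGne hv0
  have hG : RealEntireLt2 (iteratedDeriv j f) := RhW08.WindowLoss.realEntireLt2_iteratedDeriv (RhW08.Column.realEntireLt2_of_hyps hE) j
  have hsymm : ∀ a, iteratedDeriv j f a = 0 → iteratedDeriv j f (conj a) = 0 := fun a ha => by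
    rw [apply_conj_eq_conj hG.diff hG.real, ha, map_zero]
  have hstrip : ∀ a : ℂ, iteratedDeriv j f a = 0 → |a.im| ≤ Hs := fun a ha => RhW08.Column.abs_im_le_of_level hE hGne ha
  have hzim : 0 < z.im := hvim.trans hvz
  set m : ℝ := min (v.re - v.im) (z.re - z.im) with hmdef
  set m' : ℝ := max (v.re + v.im) (z.re + z.im) with hm'def
  have hmv : m ≤ v.re - v.im := min_le_left _ _
  have hmz : m ≤ z.re - z.im := min_le_right _ _
  have hm'v : v.re + v.im ≤ m' := le_max_left _ _
  have hm'z : z.re + z.im ≤ m' := le_max_right _ _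
  -- LEFT: the other upper zeros left of `v` near the pair are finitely many; bound their `Re u + Im u` strictly below `m`
  have hvboxL : v ∈ (Ioo (m - Hs - 2) (v.re + 1) ×ℂ Ioo (-(Hs + 1)) (Hs + 1)) :=
    mem_reProdIm.2 ⟨⟨by linarith, by linarith⟩, ⟨by linarith, by linarith⟩⟩
  have hSL : {u : ℂ | (iteratedDeriv j f u = 0 ∧ u ∈ (Ioo (m - Hs - 2) (v.re + 1) ×ℂ Ioo (-(Hs + 1)) (Hs + 1))) ∧
      (0 < u.im ∧ u ≠ v ∧ u ≠ z ∧ u.re < v.re)}.Finite :=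
    (RhW08.SuccB.finite_zeros_box hGd hGne hvboxL).subset fun u hu => hu.1
  have hltL : ∀ u ∈ hSL.toFinset, u.re + u.im < m := by
    intro u hu
    rw [Set.Finite.mem_toFinset] at hu
    obtain ⟨⟨hu0, -⟩, hui, huv, huz, hlt⟩ := hu
    exact left_other_lt_min htouch hat hu0 hui huv huz hlt
  obtain ⟨M, hM1, hMm, hML⟩ := exists_strict_bound hSL.toFinset hltL
  obtain ⟨α, hαI, hGα, hHα⟩ := RhW08.Column.exists_real_ne_zero_ne_zero hGd hGne hHd hHne hMm
  -- RIGHT: mirror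
  have hvboxR : v ∈ (Ioo (v.re - 1) (m' + Hs + 2) ×ℂ Ioo (-(Hs + 1)) (Hs + 1)) :=
    mem_reProdIm.2 ⟨⟨by linarith, by linarith⟩, ⟨by linarith, by linarith⟩⟩
  have hSR : {u : ℂ | (iteratedDeriv j f u = 0 ∧ u ∈ (Ioo (v.re - 1) (m' + Hs + 2) ×ℂ Ioo (-(Hs + 1)) (Hs + 1))) ∧
      (0 < u.im ∧ u ≠ v ∧ u ≠ z ∧ v.re < u.re)}.Finite :=
    (RhW08.SuccB.finite_zeros_box hGd hGne hvboxR).subset fun u hu => hu.1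
  have hgtR : ∀ u ∈ hSR.toFinset, m' < u.re - u.im := by
    intro u hu
    rw [Set.Finite.mem_toFinset] at hu
    obtain ⟨⟨hu0, -⟩, hui, huv, huz, hgt⟩ := hu
    exact right_other_gt_max htouch hat hu0 hui huv huz hgt
  obtain ⟨M', hM'm, hM'1, hM'R⟩ := exists_strict_lower_bound hSR.toFinset hgtR
  obtain ⟨β, hβI, hGβ, hHβ⟩ := RhW08.Column.exists_real_ne_zero_ne_zero hGd hGne hHd hHne hM'm
  -- admissibility: every other upper zero left of `v` has `Re u + Im u ≤ α`, every one right of `v` has `β ≤ Re u − Im u`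
  have hleft : ∀ u, iteratedDeriv j f u = 0 → 0 < u.im → u ≠ v → u ≠ z → u.re < v.re → u.re + u.im ≤ α := by
    intro u hu0 hui huv huz hlt
    have huHs : u.im ≤ Hs := (abs_le.mp (hstrip u hu0)).2
    rcases le_or_gt u.re (m - Hs - 2) with hfar | hnear
    · linarith [hαI.1]
    · have hmem : u ∈ hSL.toFinset := by
        rw [Set.Finite.mem_toFinset]
        exact ⟨⟨hu0, mem_reProdIm.2 ⟨⟨hnear, by linarith⟩, ⟨by linarith, by linarith⟩⟩⟩, hui, huv, huz, hlt⟩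
      linarith [hML u hmem, hαI.1]
  have hright : ∀ u, iteratedDeriv j f u = 0 → 0 < u.im → u ≠ v → u ≠ z → v.re < u.re → β ≤ u.re - u.im := by
    intro u hu0 hui huv huz hgt
    have huHs : u.im ≤ Hs := (abs_le.mp (hstrip u hu0)).2
    rcases lt_or_ge u.re (m' + Hs + 2) with hnear | hfar
    · have hmem : u ∈ hSR.toFinset := by
        rw [Set.Finite.mem_toFinset]
        exact ⟨⟨hu0, mem_reProdIm.2 ⟨⟨by linarith, hnear⟩, ⟨by linarith, by linarith⟩⟩⟩, hui, huv, huz, hgt⟩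
      linarith [hM'R u hmem, hβI.2]
    · linarith [hβI.2]
  have hαm : α < m := hαI.2
  have hm'β : m' < β := hβI.1
  refine ⟨α, β, by linarith, by linarith, by linarith, by linarith, by linarith, by linarith,
    hcl_left_of_admissible (Z := fun a => iteratedDeriv j f a = 0) hsymm hvim hvz hat (by linarith) (by linarith) hleft,
    hcl_right_of_admissible (Z := fun a => iteratedDeriv j f a = 0) hsymm hvim hvz hat (by linarith) (by linarith) hright,
    hGα, hGβ, hHα, hHβ, ?_⟩
  exact window_upper_eq_pair (Z := fun a => iteratedDeriv j f a = 0) hv0 hz0 hvim hvz hat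
    (by linarith) (by linarith) (by linarith) (by linarith) hleft hright

/-! ## §2 HALF-NEWTON-DISC GEOMETRY — C1 g34 `PairWindowGeometry-v2` b564f84c re-homed, bodies verbatim -/

/-- `|Re K|/‖K‖² ≤ 1/‖K‖` and `|Im K|/‖K‖² ≤ 1/‖K‖` for `K ≠ 0`. -/
theorem abs_re_im_div_normSq_le {K : ℂ} (hK : K ≠ 0) :
    |K.re| / ‖K‖ ^ 2 ≤ 1 / ‖K‖ ∧ |K.im| / ‖K‖ ^ 2 ≤ 1 / ‖K‖ := by
  have hKn : 0 < ‖K‖ := norm_pos_iff.mpr hK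
  have h1 : |K.re| ≤ ‖K‖ := Complex.abs_re_le_norm K
  have h2 : |K.im| ≤ ‖K‖ := Complex.abs_im_le_norm K
  constructor
  · rw [div_le_div_iff₀ (by positivity) hKn]
    nlinarith
  · rw [div_le_div_iff₀ (by positivity) hKn]
    nlinarith

/-- (L1) HALF-NEWTON-DISC WINDOW: `‖u − (v − K⁻¹)‖ ≤ 1/(2‖K‖)` ⇒ `|Re u − Re v| ≤ 3/(2‖K‖)` and `Im v − 3/(2‖K‖) ≤ Im u`
(`Re (v − K⁻¹) = Re v − Re K/‖K‖²`, `Im (v − K⁻¹) = Im v + Im K/‖K‖²`, each shift at most `1/‖K‖`). -/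
theorem halfDisc_window {u v K : ℂ} (hK : K ≠ 0) (hu : ‖u - (v - K⁻¹)‖ ≤ 1 / (2 * ‖K‖)) :
    |u.re - v.re| ≤ 3 / (2 * ‖K‖) ∧ v.im - 3 / (2 * ‖K‖) ≤ u.im := by
  have hKn : 0 < ‖K‖ := norm_pos_iff.mpr hK
  obtain ⟨hre, him⟩ := abs_re_im_div_normSq_le hK
  have hR : |(u - (v - K⁻¹)).re| ≤ 1 / (2 * ‖K‖) := (Complex.abs_re_le_norm _).trans hu
  have hI : |(u - (v - K⁻¹)).im| ≤ 1 / (2 * ‖K‖) := (Complex.abs_im_le_norm _).trans hu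
  have eR : (u - (v - K⁻¹)).re = (u.re - v.re) + K.re / ‖K‖ ^ 2 := by
    rw [Complex.sub_re, Complex.sub_re, Complex.inv_re, Complex.normSq_eq_norm_sq]; ring
  have eI : (u - (v - K⁻¹)).im = (u.im - v.im) - K.im / ‖K‖ ^ 2 := by
    rw [Complex.sub_im, Complex.sub_im, Complex.inv_im, Complex.normSq_eq_norm_sq]; ring
  rw [eR] at hR
  rw [eI] at hI
  have e3 : 3 / (2 * ‖K‖) = 1 / (2 * ‖K‖) + 1 / ‖K‖ := by field_simp; ring
  have hRa := abs_le.mp hR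
  have hIa := abs_le.mp hI
  have hrea := abs_le.mp (show |K.re / ‖K‖ ^ 2| ≤ 1 / ‖K‖ by
    rw [abs_div, abs_of_pos (by positivity : (0:ℝ) < ‖K‖ ^ 2)]; exact hre)
  have hima := abs_le.mp (show |K.im / ‖K‖ ^ 2| ≤ 1 / ‖K‖ by
    rw [abs_div, abs_of_pos (by positivity : (0:ℝ) < ‖K‖ ^ 2)]; exact him)
  constructor
  · rw [e3, abs_le]; constructor <;> linarith
  · rw [e3]; linarith

/-- (L2) THE FLOOR IN FIELD UNITS: `0 < Im v` and `30 ≤ Im v·‖K + I/(2·Im v)‖` ⇒ `59/2 ≤ Im v·‖K‖`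
(`‖K + I/(2 Im v)‖ ≤ ‖K‖ + 1/(2 Im v)`). -/
theorem floor_newton_of_floor_tilt {K : ℂ} {y : ℝ} (hy : 0 < y) (hfl : 30 ≤ y * ‖K + Complex.I / (2 * (y : ℂ))‖) :
    59 / 2 ≤ y * ‖K‖ := by
  have hn : ‖Complex.I / (2 * (y : ℂ))‖ = 1 / (2 * y) := by
    rw [norm_div, Complex.norm_I, norm_mul, Complex.norm_ofNat, Complex.norm_real, Real.norm_eq_abs, abs_of_pos hy]
  have htri : ‖K + Complex.I / (2 * (y : ℂ))‖ ≤ ‖K‖ + 1 / (2 * y) := (norm_add_le _ _).trans (by rw [hn])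
  have h1 : y * ‖K + Complex.I / (2 * (y : ℂ))‖ ≤ y * ‖K‖ + 1 / 2 := by
    calc y * ‖K + Complex.I / (2 * (y : ℂ))‖ ≤ y * (‖K‖ + 1 / (2 * y)) := mul_le_mul_of_nonneg_left htri hy.le
      _ = y * ‖K‖ + 1 / 2 := by field_simp
  linarith

/-- (L3) STEP 2 OF THE `ChildEnergyTwoLeQ` KERNEL: `K ≠ 0`, the WEAK floor `3/2 < Im v·‖K‖` (so `0 < Im v`) and `u` in the half-Newton disc ⇒
`u` lies in the OPEN pair strip of `v`: `Re v − Im v < Re u < Re v + Im v` and `0 < Im u`.  (At `v` the floor `λ ≥ 30` gives `59/2`, (L3′); at the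
toucher `z` THIS weak floor is exactly the missing binder flagged in RESULT-14.) -/
theorem mem_strip_of_halfDisc {u v K : ℂ} (hK : K ≠ 0) (hfl : 3 / 2 < v.im * ‖K‖)
    (hu : ‖u - (v - K⁻¹)‖ ≤ 1 / (2 * ‖K‖)) :
    v.re - v.im < u.re ∧ u.re < v.re + v.im ∧ 0 < u.im := by
  have hKn : 0 < ‖K‖ := norm_pos_iff.mpr hK
  obtain ⟨hre, him⟩ := halfDisc_window hK hu
  have h32 : 3 / (2 * ‖K‖) < v.im := by
    rw [div_lt_iff₀ (by positivity)]; nlinarith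
  have hrea := abs_le.mp hre
  exact ⟨by linarith, by linarith, by linarith⟩

/-- `K ≠ 0` from the weak floor. -/
theorem ne_zero_of_floor {K : ℂ} {y : ℝ} (hfl : 3 / 2 < y * ‖K‖) : K ≠ 0 := by
  intro h; rw [h, norm_zero, mul_zero] at hfl; linarith

/-- (L3′) the same from lens-2ʼs floor shape `30 ≤ Im v·‖K + I/(2 Im v)‖` (`stateKappa`, `tiltAt = newtonK + I/(2 Im v)`). -/
theorem mem_strip_of_halfDisc_tilt {u v K : ℂ} (hv : 0 < v.im) (hK : K ≠ 0)
    (hfl : 30 ≤ v.im * ‖K + Complex.I / (2 * (v.im : ℂ))‖) (hu : ‖u - (v - K⁻¹)‖ ≤ 1 / (2 * ‖K‖)) :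
    v.re - v.im < u.re ∧ u.re < v.re + v.im ∧ 0 < u.im :=
  mem_strip_of_halfDisc hK (by have := floor_newton_of_floor_tilt hv hfl; linarith) hu

/-- (L4) STEP 3(a): an UPPER point of the closed Jensen disc `‖u − Re v‖ ≤ Im v` has abscissa in the OPEN interval `(Re v − Im v, Re v + Im v)`
(on the boundary abscissae the disc meets only the real axis). -/
theorem re_mem_Ioo_of_mem_jensenDisc {u v : ℂ} (hd : ‖u - (v.re : ℂ)‖ ≤ v.im) (hu : 0 < u.im) :
    v.re - v.im < u.re ∧ u.re < v.re + v.im := by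
  have hre : (u - (v.re : ℂ)).re = u.re - v.re := by simp
  have him : (u - (v.re : ℂ)).im = u.im := by simp
  have hv : 0 ≤ v.im := (norm_nonneg _).trans hd
  have hsq : ‖u - (v.re : ℂ)‖ ^ 2 ≤ v.im ^ 2 := pow_le_pow_left₀ (norm_nonneg _) hd 2
  rw [Complex.sq_norm, Complex.normSq_apply, hre, him] at hsq
  have hlt : (u.re - v.re) * (u.re - v.re) < v.im * v.im := by nlinarith
  constructor
  · nlinarith
  · nlinarith

/-- (L4′) the `pairUnion` form: an upper point of `D̄_v ∪ D̄_z` has abscissa in `(min (Re v − Im v) (Re z − Im z), max (Re v + Im v) (Re z + Im z))`,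
hence in any `(α, β)` with `α ≤ min …`, `max … ≤ β`. -/
theorem re_mem_Ioo_of_mem_pairUnion {u v z : ℂ} {α β : ℝ} (hmem : ‖u - (v.re : ℂ)‖ ≤ v.im ∨ ‖u - (z.re : ℂ)‖ ≤ z.im) (hu : 0 < u.im)
    (hαv : α ≤ v.re - v.im) (hαz : α ≤ z.re - z.im) (hvβ : v.re + v.im ≤ β) (hzβ : z.re + z.im ≤ β) :
    α < u.re ∧ u.re < β := by
  rcases hmem with h | h
  · obtain ⟨h1, h2⟩ := re_mem_Ioo_of_mem_jensenDisc h hu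
    exact ⟨by linarith, by linarith⟩
  · obtain ⟨h1, h2⟩ := re_mem_Ioo_of_mem_jensenDisc h hu
    exact ⟨by linarith, by linarith⟩

/-! ## §3 THE THEOREM -/

/-- ★★★ (K) §3 **`childEnergy (Ū) ≤ Im u₁² + Im u₂²`** — lens-2's `ChildEnergyTwoLeQ` (RungP-v4/v5) with `BetaLevel` replaced by its `StTrkDQ … j v`
conjunct.  Legal frame; band state `v` of level `j`; `Touches f j v z`; `AtomicPair f j v z`; floors `30 ≤ Im v·stateKappa f j v` and
`3/2 < Im z·‖newtonK f j z‖`; `u₁ ≠ u₂` zeros of `f⁽ʲ⁺¹⁾` off `Z(f⁽ʲ⁾)` with `‖u₁ − (v − K_v⁻¹)‖ ≤ 1/(2‖K_v‖)`, `‖u₂ − (z − K_z⁻¹)‖ ≤ 1/(2‖K_z‖)`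
(`K_w = newtonK f j w`).  PROOF: the pair window (§4); the window count `≤ ncard {v, z} = 2` (§2); the located children lie above `(α, β)` (§5) with
order `≥ 1` (`RhW08.ClusterQM.analyticOrderNatAt_pos_of_zero`), hence ARE the window's children, each simple; the upper part of `Ū` lies above `(α, β)`
(§5); sum (§6). -/
theorem childEnergy_two_le {η : ℝ} {f : ℂ → ℂ} {x₀ s hmax R Hs : ℝ} {B j : ℕ} {v z : ℂ}
    (hE : EngineHyps5 2 η f x₀ s hmax R Hs B) (hv : StTrkDQ η f x₀ s hmax R Hs B j v)
    (ht : Touches f j v z) (ha : AtomicPair f j v z)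
    (hfl : 30 ≤ v.im * stateKappa f j v) (hflz : 3 / 2 < z.im * ‖newtonK f j z‖)
    {u₁ u₂ : ℂ} (hne : u₁ ≠ u₂) (hd1 : iteratedDeriv (j + 1) f u₁ = 0) (hG1 : iteratedDeriv j f u₁ ≠ 0)
    (hd2 : iteratedDeriv (j + 1) f u₂ = 0) (hG2 : iteratedDeriv j f u₂ ≠ 0)
    (hD1 : ‖u₁ - (v - (newtonK f j v)⁻¹)‖ ≤ 1 / (2 * ‖newtonK f j v‖))
    (hD2 : ‖u₂ - (z - (newtonK f j z)⁻¹)‖ ≤ 1 / (2 * ‖newtonK f j z‖)) :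
    childEnergy f j (pairUnion v z) ≤ u₁.im ^ 2 + u₂.im ^ 2 := by
  obtain ⟨hz0, hvz, htch⟩ := ht
  obtain ⟨α, β, hαv, hvβ, hαv', hαz', hvβ', hzβ', hclα, hclβ, hGα, hGβ, hdα, hdβ, hset⟩ := pairWindow hE hv hz0 hvz htch ha
  -- STEP 1: the weighted window count is `≤ ncard {v, z} = 2`, on a finite family
  obtain ⟨hfinW, hcount⟩ := clusterCount_le hE hv hαv hvβ hclα hclβ hGα hGβ hdα hdβ
  have hvzne : v ≠ z := fun h => by rw [h] at hvz; exact lt_irrefl _ hvz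
  rw [hset, Set.ncard_pair hvzne] at hcount
  -- STEP 2: the located children lie above `(α, β)`
  have hv0 : 0 < v.im := hv.2.2.1
  have hfl' : 30 ≤ v.im * ‖newtonK f j v + Complex.I / (2 * (v.im : ℂ))‖ := hfl
  have hflv : 3 / 2 < v.im * ‖newtonK f j v‖ := by
    have := floor_newton_of_floor_tilt hv0 hfl'; linarith
  have hKv : newtonK f j v ≠ 0 := ne_zero_of_floor hflv
  have hKz : newtonK f j z ≠ 0 := ne_zero_of_floor hflz
  obtain ⟨h1l, h1r, h1i⟩ := mem_strip_of_halfDisc_tilt hv0 hKv hfl' hD1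
  obtain ⟨h2l, h2r, h2i⟩ := mem_strip_of_halfDisc hKz hflz hD2
  have hW1 : u₁ ∈ {w : ℂ | (iteratedDeriv (j + 1) f w = 0 ∧ iteratedDeriv j f w ≠ 0 ∧ w.re ∈ Ioo α β) ∧ 0 < w.im} :=
    ⟨⟨hd1, hG1, ⟨by linarith, by linarith⟩⟩, h1i⟩
  have hW2 : u₂ ∈ {w : ℂ | (iteratedDeriv (j + 1) f w = 0 ∧ iteratedDeriv j f w ≠ 0 ∧ w.re ∈ Ioo α β) ∧ 0 < w.im} :=
    ⟨⟨hd2, hG2, ⟨by linarith, by linarith⟩⟩, h2i⟩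
  -- orders are positive on the window children (`f⁽ʲ⁺¹⁾ ≢ 0` by `hdα`)
  have hDne : iteratedDeriv (j + 1) f ≠ 0 := fun h => hdα (by rw [h]; rfl)
  have hDdiff : Differentiable ℂ (iteratedDeriv (j + 1) f) := differentiable_iteratedDeriv_of_entire hE.1 (j + 1)
  have hpos : ∀ w ∈ {w : ℂ | (iteratedDeriv (j + 1) f w = 0 ∧ iteratedDeriv j f w ≠ 0 ∧ w.re ∈ Ioo α β) ∧ 0 < w.im},
      1 ≤ analyticOrderNatAt (iteratedDeriv (j + 1) f) w :=
    fun w hw => RhW08.ClusterQM.analyticOrderNatAt_pos_of_zero hDdiff hDne hw.1.1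
  -- STEP 3(a): the upper part of `Ū` lies above `(α, β)`
  have hsub : {u : ℂ | (iteratedDeriv (j + 1) f u = 0 ∧ iteratedDeriv j f u ≠ 0 ∧ u ∈ pairUnion v z) ∧ 0 < u.im} ⊆
      {w : ℂ | (iteratedDeriv (j + 1) f w = 0 ∧ iteratedDeriv j f w ≠ 0 ∧ w.re ∈ Ioo α β) ∧ 0 < w.im} := by
    rintro u ⟨⟨hu0, hGu, hmem⟩, hui⟩
    exact ⟨⟨hu0, hGu, re_mem_Ioo_of_mem_pairUnion hmem hui hαv' hαz' hvβ' hzβ'⟩, hui⟩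
  -- STEP 3(b)(c)
  exact energy_le_of_count_le hfinW hcount hpos hne hW1 hW2 hsub

end RhW08.PairWindow
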